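import Summits.CriticalPhenomena.Ising3D.TaylorCoeffZMonoHalf
import Mathlib.Tactic.Linarith
import Mathlib.Tactic.Ring
import HarnessLib

/-!
# Low-order values of the q-factors (regression checks for the exact producer)
(cell `pub-ising3x`, seat boot-1; gate (g3): conventions pinned by theorems)

HONEST FRAMING: lottery ticket; floor = tightest certified 3D Ising CFT bounds; no exact-solution
claim without a proof.

`qFactor₁ s α 0 = 1`, `qFactor₁ s α 1 = α - s`, `qFactor₂ s α 0 = 1`, `qFactor₂ s α 1 = s - α`
(from `C(r,0) = 1`, `C(r,1) = r`): the order-0 and order-1 Taylor data of `(1-z)^s z^α` and `z^s (1-z)^α`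
at `z = ½` after removing the prefactor `(½)^{s+α} 2^a` — a producer's table must reproduce these signs.
Elementary.
-/

namespace Summit.CriticalPhenomena.Ising3D

open Finset

/-- `q¹(s,α;0) = 1`. [folklore] -/
theorem qFactor₁_zero (s α : ℝ) : qFactor₁ s α 0 = 1 := by
  simp [qFactor₁]

/-- `q¹(s,α;1) = α - s`. [folklore] -/
theorem qFactor₁_one (s α : ℝ) : qFactor₁ s α 1 = α - s := by
  rw [qFactor₁, Finset.Nat.antidiagonal_succ, Finset.sum_cons, Finset.sum_map]
  simp
  ring

/-- `q²(s,α;0) = 1`. [folklore] -/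
theorem qFactor₂_zero (s α : ℝ) : qFactor₂ s α 0 = 1 := by
  simp [qFactor₂]

/-- `q²(s,α;1) = s - α`. [folklore] -/
theorem qFactor₂_one (s α : ℝ) : qFactor₂ s α 1 = s - α := by
  rw [qFactor₂, Finset.Nat.antidiagonal_succ, Finset.sum_cons, Finset.sum_map]
  simp
  ring

end Summit.CriticalPhenomena.Ising3D
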